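import Summits.FinalStateConjecture.FinalStateConjecture.Theorems.PhotonSphereChannelsWindowedShellChannelsStubFarPolyShare
import Summits.FinalStateConjecture.FinalStateConjecture.Theorems.PhotonSphereChannelsWindowedShellChannelsStubDropPSD
import Summits.FinalStateConjecture.FinalStateConjecture.Theorems.PhotonSphereChannelsWindowedShellChannelsStubLateDropInvSq
import Summits.FinalStateConjecture.FinalStateConjecture.Theorems.PhotonSphereChannelsWindowedShellChannelsStubLateDropExp
import Summits.FinalStateConjecture.FinalStateConjecture.Theorems.PhotonSphereChannelsWindowedShellChannelsStubLayerSplit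
import Summits.FinalStateConjecture.FinalStateConjecture.Theorems.PhotonSphereChannelsWindowedShellChannelsGlue
import Summits.FinalStateConjecture.FinalStateConjecture.Theorems.PhotonSphereChannelsWindowedShellChannelsOfCoreHigh

/-!
# Crux `WindowedShellChannels` (stmt-FinalStateConjecture-14085), line `Sketch` — the LANDED REDUCTION of W to its kernel
# (`windowedShellChannels_of_zonePoly`: W ⇐ the polynomial-zone kernel `stub_zonePoly σ` for both time parities)

Skeleton v9 of line `Sketch` (lead c3) with every piece but the kernel landed: the composition `stub_glue` (file …Glue), the five
elementary pieces of v8 (`stub_farPolyShare` p129254, `stub_layerSplit` p130639, `stub_dropPSD` p129648, `stub_lateDropInvSq`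
p129755, `stub_lateDropExp` p129770) and seat 0's `windowedShellChannels_of_coreHigh` (p127010: the four reductions + the per-mode
residue + the high/low-mode glue).  `ZonePoly.coreHigh_of`: kernel ⇒ ℓ-uniform residue; `windowedShellChannels_of_zonePoly`:
kernel (σ = ±1) ⇒ the crux.  Conversely W implies the kernel trivially, so the crux `WindowedShellChannels` is EQUIVALENT to its
restriction to parity-pure, unit-mass, centred, finite-energy data compactly supported in a polynomial zone `[−(ℓ+2)^k, (ℓ+2)^k]` at
large ℓ — every far/near asymptotic regime is discharged.  No definitions, no sorry. [folklore in method; new]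
-/

noncomputable section

set_option linter.dupNamespace false

namespace Summit.FinalStateConjecture.FinalStateConjecture.Theorems.WindowedShellChannelsSketch

open Literature.Geometry.Lorentzian Literature.Geometry.Lorentzian.ReggeWheeler
open Summit.FinalStateConjecture.FinalStateConjecture.Theses.PhotonSphereChannels
open Filter Set MeasureTheory
open scoped ENNReal Topology

namespace ZonePoly

/-- **Kernel ⇒ ℓ-uniform residue** (`stub_coreHigh σ` of the skeleton) by the landed composition `stub_glue` and the five landed
pieces. [folklore in method; new] -/
theorem coreHigh_of (σ : ℝ)
    (hZσ : ∀ ρ : ℝ, 0 < ρ → ∃ h : ℝ, 0 ≤ h ∧ ∃ c : ℝ, 0 < c ∧ ∀ k : ℕ, ∃ ℓ₀ : ℕ,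
    ∀ (s ℓ : ℕ), s ≤ 2 → s ≤ ℓ → ℓ₀ ≤ ℓ → ∀ ψ : ℝ → ℝ → ℝ,
        IsRWSolution 1 s ℓ (tortoiseRadius one_pos 0) ψ → (∀ t x, ψ (-t) x = σ * ψ t x) →
        CauchyDataSupportedOn ψ ({x : ℝ | ρ < |x|} ∩ Icc (-(((ℓ : ℝ) + 2) ^ k)) (((ℓ : ℝ) + 2) ^ k)) →
        totalEnergy (linePotential 1 s ℓ (tortoiseRadius one_pos 0)) ψ 0 ≠ ⊤ →
          ENNReal.ofReal c * totalEnergy (linePotential 1 s ℓ (tortoiseRadius one_pos 0)) ψ 0 ≤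
            channelEnergy (linePotential 1 s ℓ (tortoiseRadius one_pos 0)) 0 (ρ - h) ψ atTop) :
    ∀ ρ : ℝ, 0 < ρ → ∃ ℓ₀ : ℕ, ∃ h : ℝ, 0 ≤ h ∧ ∃ c : ℝ, 0 < c ∧
    ∀ (s ℓ : ℕ), s ≤ 2 → s ≤ ℓ → ℓ₀ ≤ ℓ → ∀ ψ : ℝ → ℝ → ℝ,
        IsRWSolution 1 s ℓ (tortoiseRadius one_pos 0) ψ → (∀ t x, ψ (-t) x = σ * ψ t x) →
        CauchyDataSupportedOn ψ {x : ℝ | ρ < |x|} →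
        totalEnergy (linePotential 1 s ℓ (tortoiseRadius one_pos 0)) ψ 0 ≠ ⊤ →
          ENNReal.ofReal c * totalEnergy (linePotential 1 s ℓ (tortoiseRadius one_pos 0)) ψ 0 ≤
            channelEnergy (linePotential 1 s ℓ (tortoiseRadius one_pos 0)) 0 (ρ - h) ψ atTop :=
  stub_glue σ hZσ stub_farPolyShare (stub_layerSplit σ) stub_dropPSD stub_lateDropInvSq stub_lateDropExp

end ZonePoly

/-- **The crux reduced to its kernel**: `WindowedShellChannels` follows from the polynomial-zone kernel for both time parities
(`σ = 1` even, `σ = −1` odd). [folklore in method; new] -/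
theorem windowedShellChannels_of_zonePoly
    (HZ : ∀ σ : ℝ, ∀ ρ : ℝ, 0 < ρ → ∃ h : ℝ, 0 ≤ h ∧ ∃ c : ℝ, 0 < c ∧ ∀ k : ℕ, ∃ ℓ₀ : ℕ,
    ∀ (s ℓ : ℕ), s ≤ 2 → s ≤ ℓ → ℓ₀ ≤ ℓ → ∀ ψ : ℝ → ℝ → ℝ,
        IsRWSolution 1 s ℓ (tortoiseRadius one_pos 0) ψ → (∀ t x, ψ (-t) x = σ * ψ t x) →
        CauchyDataSupportedOn ψ ({x : ℝ | ρ < |x|} ∩ Icc (-(((ℓ : ℝ) + 2) ^ k)) (((ℓ : ℝ) + 2) ^ k)) →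
        totalEnergy (linePotential 1 s ℓ (tortoiseRadius one_pos 0)) ψ 0 ≠ ⊤ →
          ENNReal.ofReal c * totalEnergy (linePotential 1 s ℓ (tortoiseRadius one_pos 0)) ψ 0 ≤
            channelEnergy (linePotential 1 s ℓ (tortoiseRadius one_pos 0)) 0 (ρ - h) ψ atTop) :
    WindowedShellChannels :=
  windowedShellChannels_of_coreHigh fun σ => ZonePoly.coreHigh_of σ (HZ σ)

end Summit.FinalStateConjecture.FinalStateConjecture.Theorems.WindowedShellChannelsSketch

end
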